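import Summits.AtomisticToContinuum.FouriersLaw.Theses.HonestZwanzig
import Summits.AtomisticToContinuum.FouriersLaw.Theorems.HonestZwanzigOrthogonalOhmG0PosDefAux1
import Summits.AtomisticToContinuum.FouriersLaw.Theorems.HonestZwanzigOrthogonalOhmG0PosDefAux2

/-!
# HonestZwanzig / OrthogonalOhm — stub F `G0PosDef`: the zero-frequency energy Gram matrix is positive definite

Support file for crux item `stmt-AtomisticToContinuum-12693` (`HonestZwanzig.OrthogonalOhm`, sub-problem
`FouriersLaw`), line `Sketch`: stub F `stub_G0PosDef` of skeleton v4 (= the conclusion `g0PosDef_of_stubs` of the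
F-programme F1a/F1b/F2/F3 of skeleton v5, proved here outright), and the registered helper `helper_g0PosDefBracket`.

For the pinned anharmonic chain `P = pinnedChain ω₂ lam β γ` (all parameters `> 0`), both baths at `T > 0`,
`N ≥ 2`, the canonical gadgets of route `HonestZwanzig` (`corr(f,g)(t) = ⟨f, P_t g⟩_μ - μ(f)μ(g)`,
`lap_s = ∫₀^∞ e^{-st} corr`, split site energies `e_x`, `G(s)_{xy} = lap_s(e_x, e_y)`):
**`ξ ≠ 0 ⇒ ξᵀ G(0) ξ > 0`** (`stub_G0PosDef`).  Proof:

1. bilinearity (`pinnedChain_sum_lap_eq_lap_sum`, `s = 0`): `ξᵀG(0)ξ = ∫₀^∞ corr(u,u)`, `u = ∑ ξ_x e_x`;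
2. part 2 (`exists_poisson_lap_zero`): `∫₀^∞ corr(u,u) = Z⁻¹ γT ∑_b ‖∂_{p_b} v‖²_{L²(ρ)} ≥ 0` for the smooth
   Poisson solution `v` of `L v = -(u - m)` (mixing, Hörmander, Fubini, tap energy identity — all proved in the tree);
3. if the form were `≤ 0`, `∂_{p_0} v` would vanish identically (`(∂_{p_0}v)² ρ` is continuous, integrable and
   Lebesgue-a.e. zero), and the BRACKET LEMMA (`eq_zero_of_poisson_of_partialP_zero`, this file, from the slices of
   parts 1–2) forces `ξ = 0`: along `p_k ↦ t` the generator image of a `p_k`-independent `v` is affine with slope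
   `∂_{q_k} v` while the profile is `ξ_k t²/2 + …` (`stepP`: `ξ_k = 0`, `∂_{q_k} v ≡ 0`); along `q_k ↦ t` only the
   force `V'(q_{k+1} - q_k)∂_{p_{k+1}}v` and the half bond `½ξ_{k+1}V(q_{k+1} - q_k)` move, and `V` even with
   `V(1) ≠ 0 ≠ V'(1)` gives `ξ_{k+1} = 0`, `∂_{p_{k+1}} v ≡ 0` (`stepQ`); induction from the left bath.

* `stepP`, `stepQ`, `eq_zero_of_poisson_of_partialP_zero` — the bracket lemma (any chain with differentiable
  potentials, even interaction, `V(0) = 0`, `V(1) ≠ 0`, `V'(1) ≠ 0`; any bath temperatures);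
* `pinnedChain_sum_lap_zero_pos` — `ξᵀ G(0) ξ > 0` with the gadgets written out (`N ≥ 1`);
* `helper_g0PosDefBracket`, `stub_G0PosDef` — the registered signatures.
-/

noncomputable section

open MeasureTheory ProbabilityTheory Filter Topology Finset
open scoped NNReal ENNReal ContDiff
open Literature.MathematicalPhysics.KineticTheory.HeatConduction
open Summit.AtomisticToContinuum.FouriersLaw.Theorems.OddSectorIrreversibility
open Summit.AtomisticToContinuum.FouriersLaw.Theorems.OddSectorIrreversibility.Corrector
open Summit.AtomisticToContinuum.FouriersLaw.Theorems.ExtensiveSnapshotIrreversibility.TapDuality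
open Summit.AtomisticToContinuum.FouriersLaw.Theorems.SuperadditiveResistance.Kubo
open Summit.AtomisticToContinuum.FouriersLaw.Theorems.SubdiffusiveBondHeat

namespace Summit.AtomisticToContinuum.FouriersLaw.Theorems.HonestZwanzig

namespace OrthogonalOhmLine.G0PosDef

variable {N : ℕ}

/-! ### The induction along the chain -/

section Steps

variable (P : OscillatorChain) (hU : Differentiable ℝ P.U) (hV : Differentiable ℝ P.V) {T_L T_R : ℝ}
  {e : Fin N → PhaseSpace N → ℝ}
  (he : ∀ x z, e x z = z.2 x ^ 2 / 2 + P.U (z.1 x) +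
    ∑ j : Fin N, ((if j.val = x.val + 1 then P.V (z.1 j - z.1 x) / 2 else 0) +
      (if x.val = j.val + 1 then P.V (z.1 x - z.1 j) / 2 else 0)))
  {ξ : Fin N → ℝ} {m : ℝ} {v : PhaseSpace N → ℝ}
  (hpde : ∀ y, P.generator N T_L T_R v y = -((∑ x, ξ x * e x y) - m))
include hU hV he hpde

/-- **Step P**: if `v` does not depend on `p_k` then `ξ_k = 0` and `∂_{q_k} v ≡ 0` (compare the quadratic
`p_k`-dependence of `u` with the affine one of `L v`). -/
theorem stepP {k : Fin N} (hk : ∀ (x : PhaseSpace N) (t : ℝ), v (x.1, Function.update x.2 k t) = v x) :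
    ξ k = 0 ∧ ∀ x, partialQ k v x = 0 := by
  have key : ∀ (x : PhaseSpace N) (t : ℝ),
      (t - x.2 k) * partialQ k v x + ξ k * (t ^ 2 - x.2 k ^ 2) / 2 = 0 := by
    intro x t
    have h1 := hpde (x.1, Function.update x.2 k t)
    rw [generator_sliceP P hU hV T_L T_R hk x t, energyProfile_sliceP P he ξ k x t, hpde x] at h1
    linarith
  have hξ : ξ k = 0 := by
    have h1 := key (0 : PhaseSpace N) ((0 : PhaseSpace N).2 k + 1)
    have h2 := key (0 : PhaseSpace N) ((0 : PhaseSpace N).2 k - 1)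
    linear_combination h1 + h2
  refine ⟨hξ, fun x => ?_⟩
  have h1 := key x (x.2 k + 1)
  have h2 := key x (x.2 k - 1)
  linear_combination (h1 - h2) / 2 - (x.2 k) * hξ

/-- **Step Q**: if `v` does not depend on `q_k`, `∂_{p_{k-1}} v = ∂_{p_k} v ≡ 0` and `ξ_{k-1} = ξ_k = 0`, then
for the next site `c = k + 1`: `ξ_c = 0` and `∂_{p_c} v ≡ 0` — provided the interaction is even with
`V(0) = 0`, `V(1) ≠ 0`, `V'(1) ≠ 0` (evaluate the `q_k`-slices at `q_c - q_k ∈ {0, 1, -1}`). -/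
theorem stepQ (hV0 : P.V 0 = 0) (hV1 : P.V 1 ≠ 0) (hdV1 : deriv P.V 1 ≠ 0) (hVeven : ∀ r, P.V (-r) = P.V r)
    {k c : Fin N} (hc : c.val = k.val + 1)
    (hk : ∀ (x : PhaseSpace N) (t : ℝ), v (Function.update x.1 k t, x.2) = v x)
    (hPk : ∀ x, partialP k v x = 0) (hPa : ∀ a : Fin N, a.val + 1 = k.val → ∀ x, partialP a v x = 0)
    (hξk : ξ k = 0) (hξa : ∀ a : Fin N, a.val + 1 = k.val → ξ a = 0) :
    ξ c = 0 ∧ ∀ x, partialP c v x = 0 := by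
  -- `V' ` is odd and vanishes at `0`
  have hVd : Differentiable ℝ P.V := hV
  have hdVodd : ∀ r, deriv P.V (-r) = -deriv P.V r := by
    intro r
    have h1 : deriv (fun s => P.V (-s)) r = -deriv P.V (-r) := by
      rw [deriv_comp_neg P.V r]
    have h2 : (fun s => P.V (-s)) = P.V := funext hVeven
    rw [h2] at h1
    linarith
  have hdV0 : deriv P.V 0 = 0 := by
    have := hdVodd 0
    rw [neg_zero] at this
    linarith
  have key : ∀ (x : PhaseSpace N) (t : ℝ),
      -((deriv P.V (x.1 c - t) - deriv P.V (x.1 c - x.1 k)) * partialP c v x) +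
        ξ c * (P.V (x.1 c - t) - P.V (x.1 c - x.1 k)) / 2 = 0 := by
    intro x t
    have h1 := hpde (Function.update x.1 k t, x.2)
    rw [generator_sliceQ P hU hV T_L T_R hc hk hPk hPa x t, energyProfile_sliceQ P he ξ hc hξk hξa x t,
      hpde x] at h1
    linarith
  have three : ∀ x : PhaseSpace N, ξ c * P.V 1 = 0 ∧ deriv P.V 1 * partialP c v x = 0 := by
    intro x
    have h0 := key x (x.1 c)
    have h1 := key x (x.1 c - 1)
    have h2 := key x (x.1 c + 1)
    rw [sub_self, hV0, hdV0] at h0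
    rw [sub_sub_cancel] at h1
    rw [show x.1 c - (x.1 c + 1) = -1 by ring, hVeven, hdVodd] at h2
    constructor
    · linear_combination h1 + h2 - 2 * h0
    · linear_combination (h2 - h1) / 2
  have hξc : ξ c = 0 := by
    rcases mul_eq_zero.1 (three (0 : PhaseSpace N)).1 with h | h
    · exact h
    · exact absurd h hV1
  refine ⟨hξc, fun x => ?_⟩
  rcases mul_eq_zero.1 (three x).2 with h | h
  · exact absurd h hdV1
  · exact h

/-- **The bracket lemma** (unique continuation along the chain): for an oscillator chain with differentiable
potentials and an even interaction with `V(0) = 0`, `V(1) ≠ 0`, `V'(1) ≠ 0`, a differentiable `v` solving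
`L_{T_L,T_R} v = -(∑ ξ_x e_x - m)` pointwise with `∂_{p_0} v ≡ 0` forces `ξ = 0`. -/
theorem eq_zero_of_poisson_of_partialP_zero (hV0 : P.V 0 = 0) (hV1 : P.V 1 ≠ 0) (hdV1 : deriv P.V 1 ≠ 0)
    (hVeven : ∀ r, P.V (-r) = P.V r) (hvd : Differentiable ℝ v) {i₀ : Fin N} (hi₀ : i₀.val = 0)
    (h0 : ∀ x, partialP i₀ v x = 0) : ξ = 0 := by
  -- `S n`: everything vanishes below level `n`, and `∂_{p_n} v ≡ 0`
  have S : ∀ n : ℕ, (∀ j : Fin N, j.val < n → ξ j = 0 ∧ (∀ x, partialQ j v x = 0) ∧ (∀ x, partialP j v x = 0)) ∧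
      (∀ j : Fin N, j.val = n → ∀ x, partialP j v x = 0) := by
    intro n
    induction n with
    | zero =>
      refine ⟨fun j hj => absurd hj (Nat.not_lt_zero _), fun j hj => ?_⟩
      have : j = i₀ := Fin.ext (by rw [hj, hi₀])
      subst this
      exact h0
    | succ n ih =>
      obtain ⟨ih1, ih2⟩ := ih
      -- level `n`: step P
      have hlev : ∀ j : Fin N, j.val = n → ξ j = 0 ∧ (∀ x, partialQ j v x = 0) ∧ (∀ x, partialP j v x = 0) := by
        intro j hj
        have hPj := ih2 j hj
        have hinv := invP_of_partialP_eq_zero hvd hPj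
        obtain ⟨hξj, hQj⟩ := stepP P hU hV he hpde hinv
        exact ⟨hξj, hQj, hPj⟩
      have hbelow : ∀ j : Fin N, j.val < n + 1 → ξ j = 0 ∧ (∀ x, partialQ j v x = 0) ∧ (∀ x, partialP j v x = 0) := by
        intro j hj
        rcases Nat.lt_succ_iff_lt_or_eq.1 hj with h | h
        · exact ih1 j h
        · exact hlev j h
      refine ⟨hbelow, fun c hcn x => ?_⟩
      -- level `n + 1`: step Q from the site `k` with `k.val = n`
      have hkN : n < N := by have := c.isLt; omega
      set k : Fin N := ⟨n, hkN⟩ with hk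
      obtain ⟨hξk, hQk, hPk⟩ := hlev k rfl
      have hinvQ := invQ_of_partialQ_eq_zero hvd hQk
      have hPa : ∀ a : Fin N, a.val + 1 = k.val → ∀ x, partialP a v x = 0 :=
        fun a ha => (ih1 a (by simp [hk] at ha; omega)).2.2
      have hξa : ∀ a : Fin N, a.val + 1 = k.val → ξ a = 0 :=
        fun a ha => (ih1 a (by simp [hk] at ha; omega)).1
      have hc : c.val = k.val + 1 := by rw [hcn]
      exact (stepQ P hU hV he hpde hV0 hV1 hdV1 hVeven hc hinvQ hPk hPa hξk hξa).2 x
  funext j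
  exact ((S (j.val + 1)).1 j (Nat.lt_succ_self _)).1

end Steps

/-! ### Positive definiteness of `G(0)` -/

section Main

variable {ω₂ lam β γ : ℝ} (hω : 0 < ω₂) (hl : 0 < lam) (hβ : 0 < β) (hγ : 0 < γ) (hN : 0 < N)
  {T : ℝ} (hT : 0 < T) {e : Fin N → PhaseSpace N → ℝ}
  (he : ∀ x z, e x z = z.2 x ^ 2 / 2 + (pinnedChain ω₂ lam β γ).U (z.1 x) +
    ∑ j : Fin N, ((if j.val = x.val + 1 then (pinnedChain ω₂ lam β γ).V (z.1 j - z.1 x) / 2 else 0) +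
      (if x.val = j.val + 1 then (pinnedChain ω₂ lam β γ).V (z.1 x - z.1 j) / 2 else 0)))
include hω hl hβ hγ hN hT he

/-- **`ξᵀ G(0) ξ > 0` for `ξ ≠ 0`**: the zero-frequency Gram matrix `G(0)_{xy} = ∫₀^∞ corr(e_x, e_y)(t) dt` of
the split site energies of the pinned anharmonic chain (all parameters `> 0`, `N ≥ 1`, `T > 0`) is positive
definite.  Bilinearity makes the quadratic form the zero-frequency autocorrelation of `u = ∑ ξ_x e_x`, which is
`Z⁻¹ γT ∑_b ‖∂_{p_b} v‖²` for the smooth Poisson solution `v` of `L v = -(u - m)` (`exists_poisson_lap_zero`);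
were it `≤ 0`, `∂_{p_0} v` would vanish identically (continuity, positive density) and the bracket lemma
(`eq_zero_of_poisson_of_partialP_zero`) would force `ξ = 0`. -/
theorem pinnedChain_sum_lap_zero_pos (ξ : Fin N → ℝ) (hξ : ξ ≠ 0) :
    0 < ∑ x, ∑ y, ξ x * (∫ t in Set.Ioi (0 : ℝ), Real.exp (-(0 * t)) *
      ((∫ z, e x z * (∫ w, e y w ∂((pinnedChain ω₂ lam β γ).transitionKernel N T T t.toNNReal z))
          ∂((pinnedChain ω₂ lam β γ).gibbsMeasure N T)) -
        (∫ z, e x z ∂((pinnedChain ω₂ lam β γ).gibbsMeasure N T)) *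
          (∫ z, e y z ∂((pinnedChain ω₂ lam β γ).gibbsMeasure N T)))) * ξ y := by
  set P := pinnedChain ω₂ lam β γ with hP
  -- the exponent `ϑ = 1/(4T)`
  have hϑ0 : (0 : ℝ) < 1 / (4 * T) := by positivity
  have h2ϑ : 2 * (1 / (4 * T)) < 1 / T := by
    rw [show 2 * (1 / (4 * T)) = (1 / T) / 2 by field_simp; ring]
    have : (0 : ℝ) < 1 / T := by positivity
    linarith
  have hnice := fun x => pinnedChain_splitSite_nice e he hω hl.le hβ.le x
  have hec : ∀ x, Continuous (e x) := fun x => (hnice x).1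
  set C : ℝ := ((N : ℝ) + 2) / (1 / (4 * T)) with hC
  have hC0 : 0 ≤ C := by positivity
  have heb : ∀ x y, |e x y| ≤ C * Real.exp ((1 / (4 * T)) * P.hamiltonian N y) :=
    fun x y => (hnice x).2.2.2 _ hϑ0 y
  rw [pinnedChain_sum_lap_eq_lap_sum hω hl.le hβ hγ hN hT hϑ0 h2ϑ hec hC0 heb ξ le_rfl]
  -- the profile `u = ∑ ξ_x e_x` is smooth and nice
  have hus : ContDiff ℝ ∞ fun z : PhaseSpace N => ∑ x, ξ x * e x z :=
    ContDiff.sum fun x _ => contDiff_const.mul (contDiff_splitSite he x)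
  have hub : ∀ y, |∑ x, ξ x * e x y| ≤ (∑ x, |ξ x| * C) * Real.exp ((1 / (4 * T)) * P.hamiltonian N y) :=
    fun y => abs_sum_mul_le_exp_bound Finset.univ heb ξ y
  have hCu : 0 ≤ ∑ x, |ξ x| * C := Finset.sum_nonneg fun x _ => mul_nonneg (abs_nonneg _) hC0
  obtain ⟨v, hv, hpde, hmem, hid⟩ := exists_poisson_lap_zero hω hl hβ hγ hN hT hϑ0 h2ϑ hus hCu hub
  rw [hid]
  -- positivity of the Dirichlet form at the left bath
  have hZ : 0 < ∫ x, P.gibbsDensity N T x :=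
    integral_exp_pos (pinnedChain_integrable_gibbsDensity hω hl.le hβ.le γ N hT)
  set i₀ : Fin N := ⟨0, hN⟩ with hi₀
  have hw0 : 0 < OscillatorChain.bathWeight N i₀ := by
    unfold OscillatorChain.bathWeight
    rw [if_pos rfl]
    split_ifs <;> norm_num
  have hρc : Continuous (P.gibbsDensity N T) := pinnedChain_continuous_gibbsDensity ω₂ lam β γ N T
  have hI0 : ∀ i, 0 ≤ ∫ x, partialP i v x ^ 2 * P.gibbsDensity N T x := fun i =>
    integral_nonneg fun x => mul_nonneg (sq_nonneg _) (P.gibbsDensity_pos N T x).le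
  have hpos : 0 < ∫ x, partialP i₀ v x ^ 2 * P.gibbsDensity N T x := by
    by_contra hle
    have hzero : ∫ x, partialP i₀ v x ^ 2 * P.gibbsDensity N T x = 0 := le_antisymm (not_lt.1 hle) (hI0 i₀)
    have hint : Integrable (fun x => partialP i₀ v x ^ 2 * P.gibbsDensity N T x) :=
      integrable_sq_mul_gibbsDensity hω hl.le hβ.le γ N hT (hmem i₀ hw0)
    have hae : (fun x => partialP i₀ v x ^ 2 * P.gibbsDensity N T x) =ᵐ[volume] 0 :=
      (integral_eq_zero_iff_of_nonneg (fun x => mul_nonneg (sq_nonneg _) (P.gibbsDensity_pos N T x).le)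
        hint).1 hzero
    haveI := isAddHaarMeasure_volume_phaseSpace N
    have hcont : Continuous fun x => partialP i₀ v x ^ 2 * P.gibbsDensity N T x :=
      ((continuous_partialP hv (by simp) i₀).pow 2).mul hρc
    have hall := (hcont.ae_eq_iff_eq volume continuous_const).1 hae
    have h0 : ∀ x, partialP i₀ v x = 0 := fun x => by
      have h1 := congrFun hall x
      have h2 := (mul_eq_zero.1 h1).resolve_right (P.gibbsDensity_pos N T x).ne'
      exact (pow_eq_zero_iff two_ne_zero).1 h2
    -- the bracket lemma
    have hUd : Differentiable ℝ P.U := (pinnedChain_contDiff_U ω₂ lam β γ (n := 1)).differentiable one_ne_zero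
    have hVd : Differentiable ℝ P.V := (pinnedChain_contDiff_V ω₂ lam β γ (n := 1)).differentiable one_ne_zero
    have hV0 : P.V 0 = 0 := by show (0 : ℝ) ^ 2 / 2 + β * 0 ^ 4 / 4 = 0; norm_num
    have hV1 : P.V 1 ≠ 0 := by
      have : (0 : ℝ) < 1 ^ 2 / 2 + β * 1 ^ 4 / 4 := by positivity
      exact this.ne'
    have hdV1 : deriv P.V 1 ≠ 0 := by
      rw [hP, pinnedChain_deriv_V]
      have : (0 : ℝ) < 1 + β * 1 ^ 3 := by positivity
      exact this.ne'
    have hVeven : ∀ r, P.V (-r) = P.V r := fun r => by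
      show (-r) ^ 2 / 2 + β * (-r) ^ 4 / 4 = r ^ 2 / 2 + β * r ^ 4 / 4; ring
    have hξ0 : ξ = 0 :=
      eq_zero_of_poisson_of_partialP_zero P hUd hVd he hpde hV0 hV1 hdV1 hVeven
        (hv.differentiable (by simp)) (show i₀.val = 0 from rfl) h0
    exact hξ hξ0
  refine mul_pos (inv_pos.2 hZ) (mul_pos (mul_pos hγ hT) ?_)
  exact Finset.sum_pos' (fun i _ => mul_nonneg (Corrector.bathWeight_nonneg N i) (hI0 i))
    ⟨i₀, Finset.mem_univ _, mul_pos hw0 hpos⟩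

end Main

end OrthogonalOhmLine.G0PosDef

/-! ## Registered signatures -/

open OrthogonalOhmLine.G0PosDef in
/-- **Registered helper stub** (`helper_g0PosDefBracket`, sub-goal of stub F `stub_G0PosDef` of crux
stmt-AtomisticToContinuum-12693): the bracket lemma — a differentiable solution of `L v = -(∑ ξ_x e_x - m)` with
`∂_{p_0} v ≡ 0` has `ξ = 0` (= `eq_zero_of_poisson_of_partialP_zero`). -/
theorem helper_g0PosDefBracket : ∀ (P : Literature.MathematicalPhysics.KineticTheory.HeatConduction.OscillatorChain), Differentiable ℝ P.U → Differentiable ℝ P.V → P.V 0 = 0 → P.V 1 ≠ 0 → deriv P.V 1 ≠ 0 → (∀ r : ℝ, P.V (-r) = P.V r) → ∀ (N : ℕ) (T_L T_R : ℝ) (e : Fin N → Literature.MathematicalPhysics.KineticTheory.HeatConduction.PhaseSpace N → ℝ), (∀ (x : Fin N) (z : Literature.MathematicalPhysics.KineticTheory.HeatConduction.PhaseSpace N), e x z = z.2 x ^ 2 / 2 + P.U (z.1 x) + ∑ j : Fin N, ((if j.val = x.val + 1 then P.V (z.1 j - z.1 x) / 2 else 0) + (if x.val = j.val + 1 then P.V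 (z.1 x - z.1 j) / 2 else 0))) → ∀ (ξ : Fin N → ℝ) (m : ℝ) (v : Literature.MathematicalPhysics.KineticTheory.HeatConduction.PhaseSpace N → ℝ), Differentiable ℝ v → (∀ y, P.generator N T_L T_R v y = -((∑ x, ξ x * e x y) - m)) → ∀ i₀ : Fin N, i₀.val = 0 → (∀ x, Literature.MathematicalPhysics.KineticTheory.HeatConduction.partialP i₀ v x = 0) → ξ = 0 :=
  fun P hU hV hV0 hV1 hdV1 hVeven _ _ _ _ he _ _ _ hvd hpde _ hi₀ h0 =>
    eq_zero_of_poisson_of_partialP_zero P hU hV he hpde hV0 hV1 hdV1 hVeven hvd hi₀ h0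

open OrthogonalOhmLine.G0PosDef in
/-- **Stub F** (`G0PosDef`, line `Sketch`, skeleton v4 of crux `stmt-AtomisticToContinuum-12693`): the zero-frequency
energy Gram matrix `G(0)_{xy} = ∫₀^∞ corr(e_x,e_y)(t) dt` (the route's `G` at `s = 0`) of the pinned anharmonic chain
is positive definite at every `N ≥ 2`: the asymptotic variance `2∫₀^∞ corr(u,u)` of every non-zero energy profile
`u = Σ ξ_x e_x` is positive. -/
theorem stub_G0PosDef :
    ∀ ω₂ lam β γ : ℝ, 0 < ω₂ → 0 < lam → 0 < β → 0 < γ → ∀ T : ℝ, 0 < T → ∀ N : ℕ, 2 ≤ N → let P := Literature.MathematicalPhysics.KineticTheory.HeatConduction.pinnedChain ω₂ lam β γ; let X := Literature.MathematicalPhysics.KineticTheory.HeatConduction.PhaseSpace N; let μ : MeasureTheory.Measure X := P.gibbsMeasure N T; let corr : (X → ℝ) → (X → ℝ) → ℝ → ℝ := fun f g t => (∫ z, f z * (∫ y, g y ∂(P.transitionKernel N T T t.toNNReal z)) ∂μ) - (∫ z, f z ∂μ) * (∫ z, g z ∂μ); let lap : ℝ → (X → ℝ) → (X → ℝ) → ℝ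 := fun s f g => ∫ t in Set.Ioi (0 : ℝ), Real.exp (-(s * t)) * corr f g t; let e : Fin N → X → ℝ := fun x z => z.2 x ^ 2 / 2 + P.U (z.1 x) + ∑ j : Fin N, ((if j.val = x.val + 1 then P.V (z.1 j - z.1 x) / 2 else 0) + (if x.val = j.val + 1 then P.V (z.1 x - z.1 j) / 2 else 0)); let G : ℝ → Matrix (Fin N) (Fin N) ℝ := fun s => Matrix.of fun x y => lap s (e x) (e y);
      ∀ ξ : Fin N → ℝ, ξ ≠ 0 → 0 < ∑ x : Fin N, ∑ y : Fin N, ξ x * G 0 x y * ξ y := by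
  intro ω₂ lam β γ hω hl hβ hγ T hT N hN P X μ corr lap e G ξ hξ
  exact pinnedChain_sum_lap_zero_pos hω hl hβ hγ (by omega) hT (e := e) (fun x z => rfl) ξ hξ


end Summit.AtomisticToContinuum.FouriersLaw.Theorems.HonestZwanzig

end
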